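import Literature.AnabelianGeometry.SemiGraphs.MetabelianLeafStarLeafLocalCollapse
import HarnessLib

/-!
# An element of `π₁^temp(𝒢⋆(p))` whose fixed edges all lie over ONE base edge is ANCHORED
# («EXOTIC-ISOLATION@STAR», file F3: pure type ⇒ a compatible thread of fixed centre vertices)

Mochizuki, *Semi-graphs of anabelioids*, Publ. RIMS **42** (2006), §3, Theorem 3.7 (iii) pp. 40–41, with the
author's Comments (May 2020) (6)(a) ("the unique elements of the `V_j` … form a compatible system of vertices fixed
by `H`. Thus … `H` is contained in some verticial subgroup"), Remark 2.2.1 p. 24, Lemma 1.8 (ii) p. 20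
[cite: MochizukiSemiAnbd2006, Thm 3.7(iii) pp.40-41].

PROOF-ONLY file (abc-iut cell, layer L3, row «EXOTIC-ISOLATION@STAR», seat abc-iut-L3-t8 gen 9; no definition, no
named fact).  Canonical chart of the rayless star `𝒢⋆(p) = metabelianLeafStar p`, centre sequence `P₀`, leaf
sequences `P_n = leafSeq P₀ n`, `ψ_n = psiLeaf P₀ n`.  THEOREM (`exists_mem_verticialSubgroups_of_pure`): let
`d ∈ π₁^temp(𝒢⋆(p))` be seen by an `a`-character (`Φ_{(1,0)}^{(e₀)}(d) ≠ 1`, file F2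
`MetabelianLeafStarAnchorFreeCertificate.lean`) and suppose that from a level `i₁` on `d` fixes some edge of every
`𝒢_{∞,i}` and EVERY `d`-fixed edge lies over the one base edge `n` («pure type `n`», the BAD-edge output of F2).
Then `d` lies in a VERTICIAL subgroup:

* **`exists_level_forall_fixed_centre_vertex_eq`** — at pure levels `i ≥ I(j)` ANY TWO `d`-fixed centre-type
  vertices have the same image in `𝒢_{∞,j}` (walk induction along the `d`-fixed subdivision path between them,
  Lemma 1.8 (ii)(b), two edges at a time through the LEAF-LOCAL COLLAPSE of F3b
  `MetabelianLeafStarLeafLocalCollapse.lean`);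
* **`exists_mem_verticialSubgroups_of_pure`** — hence the images form a COMPATIBLE THREAD of `d`-fixed vertices
  and (I2) `stab_temperedPiChart` puts `d` in a verticial subgroup; `exists_verticial_ge_zpowers_of_pure` — and
  `⟨d⟩‾` with it (verticial subgroups are compact, hence closed).

Consumer: F4 `MetabelianLeafStarExoticIsolation.lean` (an anchor-free compact-generating element has NO bad base
edge, hence a full edge certificate).  Honest framing: OUR typed tempered fundamental group of OUR countable
carrier `𝒢⋆(p)`; print's Thm 3.7 at finite `𝔾` untouched; nothing here bears on [IUTchIII] Cor. 3.12; no side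
taken; typed ≠ proved.
-/

noncomputable section

open CategoryTheory Topology Multiplicative Filter

namespace Literature.AnabelianGeometry.SemiGraphs

open IwahoriWitness

namespace ProfiniteSemiGraph

variable {p : ℕ} [hp : Fact p.Prime] {h36 : (metabelianLeafStar p).Prop36Hypotheses}
  (P₀ : ((metabelianLeafStar p).galoisLevelData h36).PointSeq h36.isCountable (leafStarCentre p))

/-! ### At pure levels, all fixed centre-type vertices have ONE image -/

include P₀ in
/-- **At PURE levels all `d`-fixed centre-type vertices collapse to one vertex of `𝒢_{∞,j}`.**  Let `Φ₀` (an
`a`-character modulo `p^{e₀}`, level `j₀`) see `d`.  For every `j` there is a level `I ≥ j` such that for all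
`i ≥ I` at which EVERY `d`-fixed edge lies over the base edge `n`: any two `d`-fixed centre-type vertices
`(g·P₀).vertex i`, `(g'·P₀).vertex i` satisfy `(g·P₀).vertex j = (g'·P₀).vertex j`.  Walk induction (step `8`)
along the `d`-fixed subdivision path between them (Lemma 1.8 (ii)(b)): centre → leaf `n` → centre, the two edges
at the leaf vertex being glued edges of `x·P₀` and `(x ψ_n(l))·P₀`, collapsed at level `j` by
`exists_level_leafLocalCollapse`. [cite: MochizukiSemiAnbd2006, Thm 3.7(iii) pp.40-41] -/
theorem exists_level_forall_fixed_centre_vertex_eq (n : ℕ) {e₀ : ℕ}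
    (Φ₀ : ((metabelianLeafStar p).galoisLevelData h36).temperedPi h36.isCountable →* Multiplicative (ZMod (p ^ e₀)))
    (hΦ₀L : ∀ (m : ℕ) (Q : ((metabelianLeafStar p).galoisLevelData h36).PointSeq h36.isCountable (leafStarLeaf p m))
      (y : Iw.Leaf (p := p) m), Φ₀ (Q.decompHom y) = Iw.logChar m e₀ (1 + 0 * (p : ZMod (p ^ e₀)) ^ m) y)
    {j₀ : ℕ} (hker₀ : ∀ j, j₀ ≤ j → ∀ g, ((metabelianLeafStar p).galoisLevelData h36).proj h36.isCountable j g = 1 →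
      Φ₀ g = 1)
    (d : ((metabelianLeafStar p).galoisLevelData h36).temperedPi h36.isCountable) (hΦ₀d : Φ₀ d ≠ 1) (j : ℕ) :
    ∃ I : ℕ, j ≤ I ∧ ∀ i, I ≤ i →
      (∀ ε : (((metabelianLeafStar p).galoisLevelData h36).tree i).Edge,
        (((metabelianLeafStar p).galoisLevelData h36).treeAct h36.isCountable i d).hom.edgeMap ε = ε →
          (((metabelianLeafStar p).galoisLevelData h36).treeProj i).edgeMap ε = n) →
      ∀ g g' : ((metabelianLeafStar p).galoisLevelData h36).temperedPi h36.isCountable,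
        (((metabelianLeafStar p).galoisLevelData h36).treeAct h36.isCountable i d).hom.vertexMap
          ((P₀.smul g).vertex i) = (P₀.smul g).vertex i →
        (((metabelianLeafStar p).galoisLevelData h36).treeAct h36.isCountable i d).hom.vertexMap
          ((P₀.smul g').vertex i) = (P₀.smul g').vertex i →
        (P₀.smul g).vertex j = (P₀.smul g').vertex j := by
  let Dg := (metabelianLeafStar p).galoisLevelData h36
  have hc := h36.isCountable
  obtain ⟨I, hI⟩ := exists_level_leafLocalCollapse P₀ n Φ₀ hΦ₀L hker₀ d hΦ₀d j
  refine ⟨max I j, le_max_right _ _, fun i hi hpure g g' hg hg' => ?_⟩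
  have hji : j ≤ i := (le_max_right I j).trans hi
  have hIi : I ≤ i := (le_max_left I j).trans hi
  -- push a level-`i` equality of centre vertices down to level `j`
  have hpush : ∀ x y : Dg.temperedPi hc, (P₀.smul x).vertex i = (P₀.smul y).vertex i →
      (P₀.smul x).vertex j = (P₀.smul y).vertex j := by
    intro x y h
    rw [← (P₀.smul x).treeTrans_vertex hji, ← (P₀.smul y).treeTrans_vertex hji, h]
  -- the type of a branch at a centre-type / leaf-type vertex
  have htype_centre : ∀ (a : Dg.temperedPi hc) (β : (Dg.tree i).Branch),
      (Dg.tree i).abuts β = some ((P₀.smul a).vertex i) →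
        (Dg.treeProj i).branchMap β = (((Dg.treeProj i).branchMap β).1, true) := by
    intro a β hβ
    have h1 := (Dg.treeProj i).abuts_branchMap β _ hβ
    rw [(P₀.smul a).treeProj_vertexMap_vertex i] at h1
    exact SemiGraph.leafStar_abuts_eq_some_none_iff.1 h1
  have htype_leaf : ∀ (m : ℕ) (a : Dg.temperedPi hc) (β : (Dg.tree i).Branch),
      (Dg.tree i).abuts β = some (((leafSeq P₀ m).smul a).vertex i) → (Dg.treeProj i).branchMap β = (m, false) := by
    intro m a β hβ
    have h1 := (Dg.treeProj i).abuts_branchMap β _ hβ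
    rw [((leafSeq P₀ m).smul a).treeProj_vertexMap_vertex i] at h1
    exact SemiGraph.leafStar_abuts_eq_some_some_iff.1 h1
  -- the `d`-fixed path between the two fixed centre-type vertices
  obtain ⟨q, hq, -⟩ := ((Dg.isTree_tree i).isTree.connected
    (Sum.inl ((P₀.smul g).vertex i) : (Dg.tree i).Node) (Sum.inl ((P₀.smul g').vertex i))).exists_path_of_dist
  have hqfix : ∀ x ∈ q.support, SemiGraph.nodeMap (Dg.treeAct hc i d) x = x :=
    SemiGraph.nodeMap_eq_self_of_isPath (Dg.isTree_tree i).isTree.isAcyclic (Dg.treeAct hc i d)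
      (by rw [SemiGraph.nodeMap_inl, hg]) (by rw [SemiGraph.nodeMap_inl, hg']) q hq
  have hfixE : ∀ e : (Dg.tree i).Edge, (Sum.inr (Sum.inl e) : (Dg.tree i).Node) ∈ q.support →
      (Dg.treeAct hc i d).hom.edgeMap e = e := by
    intro e he
    have h := hqfix _ he
    simpa only [SemiGraph.nodeMap_inr_inl, Sum.inr.injEq, Sum.inl.injEq] using h
  -- induction along the path, two edges at a time
  have main : ∀ k : ℕ, 8 * k ≤ q.length →
      ∃ gk : Dg.temperedPi hc, q.getVert (8 * k) = Sum.inl ((P₀.smul gk).vertex i) ∧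
        (P₀.smul gk).vertex j = (P₀.smul g).vertex j := by
    intro k
    induction k with
    | zero => exact fun _ => ⟨g, by rw [Nat.mul_zero, q.getVert_zero], rfl⟩
    | succ k ih =>
      intro hk
      obtain ⟨gk, hgk, hjk⟩ := ih (by omega)
      -- first edge: centre → leaf, over `n` by purity
      obtain ⟨-, c, c', e₁, z₁, hcc', hce, hc'e, hcz, hc'z, -, h2, -, h4⟩ :=
        SemiGraph.path_inl_segment q hq (i := 8 * k) (by omega) hgk
      have he₁fix : (Dg.treeAct hc i d).hom.edgeMap e₁ = e₁ := hfixE e₁ (by rw [← h2]; exact q.getVert_mem_support _)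
      have he₁n : (Dg.treeProj i).edgeMap e₁ = n := hpure e₁ he₁fix
      have hcb : (Dg.treeProj i).branchMap c = ((n, true) : ℕ × Bool) := by
        rw [htype_centre gk c hcz]
        have h1 : ((Dg.treeProj i).branchMap c).1 = n := by
          have h3 := (Dg.treeProj i).edgeOf_branchMap c
          rw [hce, he₁n] at h3
          rw [htype_centre gk c hcz] at h3
          exact h3
        rw [h1]
      obtain ⟨x₁, hx₁v, hx₁e, hz₁⟩ := exists_centre_smul_of_branch P₀ gk i n c c' hcb hcz hcc' (hc'e.trans hce.symm) hc'z
      -- second edge: leaf `n` → centre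
      rw [hz₁] at h4
      obtain ⟨-, c₂, c₂', e₂, z₂, hcc₂, hc₂e, hc₂'e, hc₂z, hc₂'z, -, h6, -, h8⟩ :=
        SemiGraph.path_inl_segment q hq (i := 8 * k + 4) (by omega) h4
      have hc₂b := htype_leaf n x₁ c₂ hc₂z
      obtain ⟨l, he₂, hz₂⟩ := exists_leaf_smul_of_branch P₀ x₁ i n c₂ c₂' hc₂b hc₂z hcc₂ (hc₂'e.trans hc₂e.symm) hc₂'z
      have he₂fix : (Dg.treeAct hc i d).hom.edgeMap e₂ = e₂ := hfixE e₂ (by rw [← h6]; exact q.getVert_mem_support _)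
      -- leaf-local collapse at the leaf vertex `x₁·P_n`
      have hfix₁ : (Dg.treeAct hc i d).hom.edgeMap
          (((P₀.smul (x₁ * psiLeaf P₀ n 1)).toEdgeSeq ((n, true) : ℕ × Bool) (leafStar_abuts_true' p n)).edge i) =
          ((P₀.smul (x₁ * psiLeaf P₀ n 1)).toEdgeSeq ((n, true) : ℕ × Bool) (leafStar_abuts_true' p n)).edge i := by
        rw [map_one, mul_one, ← hx₁e, hce]; exact he₁fix
      have hfix₂ : (Dg.treeAct hc i d).hom.edgeMap
          (((P₀.smul (x₁ * psiLeaf P₀ n l)).toEdgeSeq ((n, true) : ℕ × Bool) (leafStar_abuts_true' p n)).edge i) =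
          ((P₀.smul (x₁ * psiLeaf P₀ n l)).toEdgeSeq ((n, true) : ℕ × Bool) (leafStar_abuts_true' p n)).edge i := by
        rw [← he₂, hc₂e]; exact he₂fix
      have hcoll := hI i hIi x₁ 1 l hfix₁ hfix₂
      rw [map_one, mul_one] at hcoll
      refine ⟨x₁ * psiLeaf P₀ n l, ?_, ?_⟩
      · rw [show 8 * (k + 1) = 8 * k + 4 + 4 by ring, h8, hz₂]
      · rw [← hcoll, hpush x₁ gk hx₁v, hjk]
  -- the length is a multiple of `8`
  have h4 : 4 * (q.length / 4) = q.length := by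
    by_contra hne
    have hlt : 4 * (q.length / 4) < q.length := lt_of_le_of_ne (Nat.mul_div_le _ _) hne
    obtain ⟨z, hz⟩ := SemiGraph.exists_getVert_four_mul_eq_inl q hq (q.length / 4) (Nat.mul_div_le _ _)
    have h := (SemiGraph.path_inl_segment q hq hlt hz).1
    omega
  have h8 : 8 * (q.length / 8) = q.length := by
    rcases Nat.even_or_odd (q.length / 4) with ⟨i', hi'⟩ | ⟨i', hi'⟩
    · omega
    · exfalso
      have hlen : q.length = 8 * i' + 4 := by omega
      obtain ⟨gi, hgi, -⟩ := main i' (by omega)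
      obtain ⟨-, c, c', e₁, z₁, hcc', hce, hc'e, hcz, hc'z, -, h2, -, h4'⟩ :=
        SemiGraph.path_inl_segment q hq (i := 8 * i') (by omega) hgi
      have he₁fix : (Dg.treeAct hc i d).hom.edgeMap e₁ = e₁ := hfixE e₁ (by rw [← h2]; exact q.getVert_mem_support _)
      have he₁n : (Dg.treeProj i).edgeMap e₁ = n := hpure e₁ he₁fix
      have hcb : (Dg.treeProj i).branchMap c = ((n, true) : ℕ × Bool) := by
        rw [htype_centre gi c hcz]
        have h1 : ((Dg.treeProj i).branchMap c).1 = n := by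
          have h3 := (Dg.treeProj i).edgeOf_branchMap c
          rw [hce, he₁n] at h3
          rw [htype_centre gi c hcz] at h3
          exact h3
        rw [h1]
      obtain ⟨x₁, -, -, hz₁⟩ := exists_centre_smul_of_branch P₀ gi i n c c' hcb hcz hcc' (hc'e.trans hce.symm) hc'z
      rw [← hlen, q.getVert_length] at h4'
      have hzz : (P₀.smul g').vertex i = z₁ := by simpa using h4'
      have hproj := congrArg (Dg.treeProj i).vertexMap hzz
      rw [(P₀.smul g').treeProj_vertexMap_vertex i, hz₁, ((leafSeq P₀ _).smul _).treeProj_vertexMap_vertex i] at hproj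
      exact Option.some_ne_none _ hproj.symm
  obtain ⟨gK, hgK, hjK⟩ := main (q.length / 8) (by omega)
  rw [h8, q.getVert_length] at hgK
  have hvert : (P₀.smul g').vertex i = (P₀.smul gK).vertex i := by simpa using hgK
  rw [hpush g' gK hvert, hjK]

/-! ### The thread of fixed centre vertices: PURE TYPE ⇒ ANCHORED -/

include P₀ in
/-- **PURE TYPE ⇒ ANCHORED.**  Let `d ∈ π₁^temp(𝒢⋆(p))` be seen by an `a`-character `Φ₀` (leaf values
`(1 + 0·pᵐ)·log`, level `j₀`), and suppose that from the level `i₁` on `d` fixes some edge of every `𝒢_{∞,i}` and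
every `d`-fixed edge lies over the ONE base edge `n`.  Then `d` lies in a VERTICIAL subgroup: the common images
`x_j ∈ 𝒢_{∞,j}` of the `d`-fixed centre-type vertices of deep pure levels
(`exists_level_forall_fixed_centre_vertex_eq`) form a compatible system of `d`-fixed vertices, and (I2)
(`stab_temperedPiChart`) applies. [cite: MochizukiSemiAnbd2006, Thm 3.7(iii) pp.40-41] -/
theorem exists_mem_verticialSubgroups_of_pure (n : ℕ)
    (d : ((metabelianLeafStar p).galoisLevelData h36).temperedPi h36.isCountable) (i₁ : ℕ)
    (hfix : ∀ i, i₁ ≤ i → ∃ ε : (((metabelianLeafStar p).galoisLevelData h36).tree i).Edge,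
      (((metabelianLeafStar p).galoisLevelData h36).treeAct h36.isCountable i d).hom.edgeMap ε = ε)
    (hpure : ∀ i, i₁ ≤ i → ∀ ε : (((metabelianLeafStar p).galoisLevelData h36).tree i).Edge,
      (((metabelianLeafStar p).galoisLevelData h36).treeAct h36.isCountable i d).hom.edgeMap ε = ε →
        (((metabelianLeafStar p).galoisLevelData h36).treeProj i).edgeMap ε = n)
    {e₀ : ℕ}
    (Φ₀ : ((metabelianLeafStar p).galoisLevelData h36).temperedPi h36.isCountable →* Multiplicative (ZMod (p ^ e₀)))
    (hΦ₀L : ∀ (m : ℕ) (Q : ((metabelianLeafStar p).galoisLevelData h36).PointSeq h36.isCountable (leafStarLeaf p m))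
      (y : Iw.Leaf (p := p) m), Φ₀ (Q.decompHom y) = Iw.logChar m e₀ (1 + 0 * (p : ZMod (p ^ e₀)) ^ m) y)
    {j₀ : ℕ} (hker₀ : ∀ j, j₀ ≤ j → ∀ g, ((metabelianLeafStar p).galoisLevelData h36).proj h36.isCountable j g = 1 →
      Φ₀ g = 1)
    (hΦ₀d : Φ₀ d ≠ 1) :
    ∃ (v : (metabelianLeafStar p).graph.Vertex) (H : Subgroup ((metabelianLeafStar p).temperedPiChart h36).G),
      H ∈ verticialSubgroups ((metabelianLeafStar p).temperedPiChart h36) v ∧ d ∈ H := by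
  classical
  let Dg := (metabelianLeafStar p).galoisLevelData h36
  have hc := h36.isCountable
  let D₀ : VerticialLevelData.{0} (metabelianLeafStar p) ((metabelianLeafStar p).temperedPiChart h36) :=
    verticialLevelData_temperedPiChart (h36 := h36)
  -- a `d`-fixed centre-type vertex at every level `i ≥ i₁`
  have hcv : ∀ i, i₁ ≤ i → ∃ a : Dg.temperedPi hc,
      (Dg.treeAct hc i d).hom.vertexMap ((P₀.smul a).vertex i) = (P₀.smul a).vertex i := by
    intro i hi
    obtain ⟨ε, hε⟩ := hfix i hi
    obtain ⟨β, hβε, hβb⟩ := SemiGraph.Hom.exists_branchMap_eq (Dg.treeProj i) ε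
      ((((Dg.treeProj i).edgeMap ε), true) : ℕ × Bool) rfl
    obtain ⟨z, hz⟩ := Dg.exists_tree_abuts_eq_some i β (w := leafStarCentre p) (by rw [hβb]; rfl)
    have hzc : (Dg.treeProj i).vertexMap z = leafStarCentre p := by
      have h := (Dg.treeProj i).abuts_branchMap β z hz
      rw [hβb] at h
      change some (leafStarCentre p) = some _ at h
      exact (Option.some.inj h).symm
    obtain ⟨a, ha⟩ := P₀.exists_smul_vertex_eq i z hzc
    refine ⟨a, ?_⟩
    rw [ha]
    exact SemiGraph.vertexMap_eq_of_branchMap_eq (Dg.treeAct hc i d)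
      (SemiGraph.branchMap_eq_of_over_aut (Dg.treeProj i) (Dg.treeAct hc i d) (Dg.treeAct_over hc i d) β
        (by rw [hβε]; exact hε)) hz
  -- the collapsing levels `I j ≥ j, i₁`
  have hlev : ∀ j, ∃ I : ℕ, j ≤ I ∧ i₁ ≤ I ∧ ∀ i, I ≤ i → ∀ g g' : Dg.temperedPi hc,
      (Dg.treeAct hc i d).hom.vertexMap ((P₀.smul g).vertex i) = (P₀.smul g).vertex i →
      (Dg.treeAct hc i d).hom.vertexMap ((P₀.smul g').vertex i) = (P₀.smul g').vertex i →
        (P₀.smul g).vertex j = (P₀.smul g').vertex j := by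
    intro j
    obtain ⟨I, hjI, hI⟩ := exists_level_forall_fixed_centre_vertex_eq P₀ n Φ₀ hΦ₀L hker₀ d hΦ₀d j
    exact ⟨max I i₁, hjI.trans (le_max_left _ _), le_max_right _ _, fun i hi g g' hg hg' =>
      hI i ((le_max_left I i₁).trans hi) (hpure i ((le_max_right I i₁).trans hi)) g g' hg hg'⟩
  choose I hjI hi₁I hI using hlev
  choose a ha using hcv
  -- the thread: `x j :=` the image in `𝒢_{∞,j}` of the fixed centre vertex chosen at level `I j`
  let x : ∀ j, (Dg.tree j).Vertex := fun j =>
    (Dg.treeTrans (hjI j)).vertexMap ((P₀.smul (a (I j) (hi₁I j))).vertex (I j))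
  -- every fixed centre-type vertex of a level `i ≥ I j` maps to `x j`
  have hxuniv : ∀ (j i : ℕ) (hIi : I j ≤ i) (g : Dg.temperedPi hc),
      (Dg.treeAct hc i d).hom.vertexMap ((P₀.smul g).vertex i) = (P₀.smul g).vertex i →
        (Dg.treeTrans ((hjI j).trans hIi)).vertexMap ((P₀.smul g).vertex i) = x j := by
    intro j i hIi g hg
    -- the image of `g·P₀`'s vertex at level `I j` is fixed and centre-type: it is `(g·P₀).vertex (I j)`
    have hgI : (Dg.treeAct hc (I j) d).hom.vertexMap ((P₀.smul g).vertex (I j)) = (P₀.smul g).vertex (I j) := by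
      have h : (Dg.treeTrans hIi).vertexMap ((Dg.treeAct hc i d).hom.vertexMap ((P₀.smul g).vertex i)) =
          (Dg.treeAct hc (I j) d).hom.vertexMap ((Dg.treeTrans hIi).vertexMap ((P₀.smul g).vertex i)) :=
        D₀.trans_act_vertexMap hIi d ((P₀.smul g).vertex i)
      rw [hg, (P₀.smul g).treeTrans_vertex hIi] at h
      exact h.symm
    have heq := hI j (I j) le_rfl g (a (I j) (hi₁I j)) hgI (ha (I j) (hi₁I j))
    change _ = (Dg.treeTrans (hjI j)).vertexMap ((P₀.smul (a (I j) (hi₁I j))).vertex (I j))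
    rw [(P₀.smul g).treeTrans_vertex, (P₀.smul (a (I j) (hi₁I j))).treeTrans_vertex, heq]
  have hcompat : ∀ ⦃j j' : ℕ⦄ (h : j ≤ j'), (Dg.treeTrans h).vertexMap (x j') = x j := by
    intro j j' h
    -- a fixed centre vertex at a level above both `I j` and `I j'`
    let i := max (I j) (I j')
    have hi₁ : i₁ ≤ i := (hi₁I j).trans (le_max_left _ _)
    have h1 := hxuniv j i (le_max_left _ _) (a i hi₁) (ha i hi₁)
    have h2 := hxuniv j' i (le_max_right _ _) (a i hi₁) (ha i hi₁)
    rw [← h2, ← h1, (P₀.smul (a i hi₁)).treeTrans_vertex, (P₀.smul (a i hi₁)).treeTrans_vertex,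
      (P₀.smul (a i hi₁)).treeTrans_vertex]
  have hdx : ∀ j, (Dg.treeAct hc j d).hom.vertexMap (x j) = x j := by
    intro j
    have h : (Dg.treeTrans (hjI j)).vertexMap
        ((Dg.treeAct hc (I j) d).hom.vertexMap ((P₀.smul (a (I j) (hi₁I j))).vertex (I j))) =
        (Dg.treeAct hc j d).hom.vertexMap
          ((Dg.treeTrans (hjI j)).vertexMap ((P₀.smul (a (I j) (hi₁I j))).vertex (I j))) :=
      D₀.trans_act_vertexMap (hjI j) d ((P₀.smul (a (I j) (hi₁I j))).vertex (I j))
    rw [ha (I j) (hi₁I j)] at h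
    exact h.symm
  obtain ⟨v, H, hH, hstab⟩ := stab_temperedPiChart (h36 := h36) x hcompat
  exact ⟨v, H, hH, hstab d hdx⟩

include P₀ in
/-- **PURE TYPE ⇒ ANCHORED, closed-subgroup form**: under the hypotheses of
`exists_mem_verticialSubgroups_of_pure`, the closed procyclic subgroup `⟨d⟩‾` lies in a verticial subgroup
(verticial subgroups are compact, hence closed). [cite: MochizukiSemiAnbd2006, Thm 3.7(iii) pp.40-41] -/
theorem exists_verticial_ge_zpowers_of_pure (n : ℕ)
    (d : ((metabelianLeafStar p).galoisLevelData h36).temperedPi h36.isCountable) (i₁ : ℕ)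
    (hfix : ∀ i, i₁ ≤ i → ∃ ε : (((metabelianLeafStar p).galoisLevelData h36).tree i).Edge,
      (((metabelianLeafStar p).galoisLevelData h36).treeAct h36.isCountable i d).hom.edgeMap ε = ε)
    (hpure : ∀ i, i₁ ≤ i → ∀ ε : (((metabelianLeafStar p).galoisLevelData h36).tree i).Edge,
      (((metabelianLeafStar p).galoisLevelData h36).treeAct h36.isCountable i d).hom.edgeMap ε = ε →
        (((metabelianLeafStar p).galoisLevelData h36).treeProj i).edgeMap ε = n)
    {e₀ : ℕ}
    (Φ₀ : ((metabelianLeafStar p).galoisLevelData h36).temperedPi h36.isCountable →* Multiplicative (ZMod (p ^ e₀)))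
    (hΦ₀L : ∀ (m : ℕ) (Q : ((metabelianLeafStar p).galoisLevelData h36).PointSeq h36.isCountable (leafStarLeaf p m))
      (y : Iw.Leaf (p := p) m), Φ₀ (Q.decompHom y) = Iw.logChar m e₀ (1 + 0 * (p : ZMod (p ^ e₀)) ^ m) y)
    {j₀ : ℕ} (hker₀ : ∀ j, j₀ ≤ j → ∀ g, ((metabelianLeafStar p).galoisLevelData h36).proj h36.isCountable j g = 1 →
      Φ₀ g = 1)
    (hΦ₀d : Φ₀ d ≠ 1) :
    ∃ (v : (metabelianLeafStar p).graph.Vertex) (H : Subgroup ((metabelianLeafStar p).temperedPiChart h36).G),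
      H ∈ verticialSubgroups ((metabelianLeafStar p).temperedPiChart h36) v ∧
      ((Subgroup.zpowers d).topologicalClosure :
        Subgroup (((metabelianLeafStar p).galoisLevelData h36).temperedPi h36.isCountable)) ≤ H := by
  haveI : T2Space ((metabelianLeafStar p).temperedPiChart h36).G :=
    ((metabelianLeafStar p).galoisLevelData h36).t2Space_temperedPi h36.isCountable
  obtain ⟨v, H, hH, hdH⟩ := exists_mem_verticialSubgroups_of_pure P₀ n d i₁ hfix hpure Φ₀ hΦ₀L hker₀ hΦ₀d
  refine ⟨v, H, hH, ?_⟩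
  obtain ⟨H₁, rfl⟩ : ∃ H₁ : Subgroup (((metabelianLeafStar p).galoisLevelData h36).temperedPi h36.isCountable),
    H₁ = H := ⟨H, rfl⟩
  have hcl : IsClosed (H₁ : Set (((metabelianLeafStar p).galoisLevelData h36).temperedPi h36.isCountable)) :=
    (isCompact_of_mem_verticialSubgroups ((metabelianLeafStar p).temperedPiChart h36) hH).isClosed
  exact Subgroup.topologicalClosure_minimal _ (Subgroup.zpowers_le.mpr hdH) hcl

end ProfiniteSemiGraph

end Literature.AnabelianGeometry.SemiGraphs

end
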